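import Summits.HodgeConjecture.CorCM.MumfordTateRankSurfaceTimesTwoCurves
import Summits.HodgeConjecture.CorCM.MumfordTateRankProductsOfCurves
import Summits.HodgeConjecture.CorCM.MumfordTateRankCurveTimesSimpleThreefold
import Summits.HodgeConjecture.CorCM.MumfordTateRankSimpleSurfacePairs
import Summits.HodgeConjecture.CorCM.MumfordTateRankThreefolds
import Summits.HodgeConjecture.CorCM.MumfordTateRankSurfaces
import Literature.AlgebraicGeometry.Motives.AbelianVarietyPoincareCompleteReducibility
import HarnessLib

/-!
# The Mumford–Tate rank of a NON-SIMPLE complex abelian FOURFOLD is one of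
# `2, 3, 4, 5, 6, 7, 8, 9, 10, 11, 12, 13, 14, 15, 17, 21, 23, 25` — the four partitions `{1,3}`, `{2,2}`, `{2,1,1}`, `{1,1,1,1}` assembled

COR-CM (cell `pub-hodgecm2`, seat `b27` gen 49, count-neutral Mumford–Tate-rank ladder; theorems only, no definition, no named fact;
UNCONDITIONAL — nothing here uses or asserts HC_CM).  Notation `t(X) = dim MT(H¹X)`.

Poincaré's complete reducibility splits a non-simple fourfold as `X ∼ A × B` with `(dim A, dim B) = (1, 3)` or `(2, 2)`
(`exists_prod_isIsogenous_of_not_isSimple_fourfold`); splitting non-simple factors further (`HodgeTheory/AbelianThreefoldsStablyNondegenerate`,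
`CorCM/MumfordTateRankSurfaces`) lands in one of the four partition tables of the lane:
* `{1,3}` — `CorCM/MumfordTateRankCurveTimesSimpleThreefold`: `{4, 5, 7, 10, 11, 13, 23, 25}`;
* `{2,2}` — `CorCM/MumfordTateRankSimpleSurfacePairs`: `{3, 4, 5, 6, 7, 9, 10, 11, 13, 14, 17, 21}`;
* `{2,1,1}` — `CorCM/MumfordTateRankSurfaceTimesTwoCurves`: `{4, …, 15, 17}`;
* `{1,1,1,1}` — `CorCM/MumfordTateRankProductsOfCurves`: `{2, …, 11, 13}`.

* **`mtRank_hodge_one_mem_of_not_isSimple_fourfold`** — the union, `18` values; in particular (`mtRank_hodge_one_not_mem_of_not_isSimple_fourfold`)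
  a non-simple abelian fourfold never has `t ∈ {16, 18, 19, 20, 22, 24}` nor `t ≥ 26`.  (Simple fourfolds are not treated here — partial rows in
  `CorCM/MumfordTateRankFourfoldsQuadraticEnd` and `CorCM/MumfordTateRankFourCM`; the full fourfold table is not claimed.)

## References
* [MoonenZarhin1999LowDim] B. Moonen, Yu. G. Zarhin, *Hodge classes on abelian varieties of low dimension*, Math. Ann. 315 (1999), §2 (2.2)–(2.5), §3,
  §5 (5.2)–(5.6) [corpus: paper:arxiv-math_9901113 pp. 5–7, 10]. [cite: MoonenZarhin1999LowDim, §3 and §5 (5.4)]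
* [MumfordAV1970] D. Mumford, *Abelian Varieties* (1970), §19 Thm. 1 (Poincaré's complete reducibility) and Cor. 1–2. [cite: MumfordAV1970, §19 Thm. 1]
-/

noncomputable section

open CategoryTheory CategoryTheory.Limits Module

namespace Summit.HodgeConjecture.CorCM

open Literature.AlgebraicGeometry.Motives
open Literature.AlgebraicGeometry.Motives.AbelianVariety
open Literature.AlgebraicGeometry.Motives.HodgeStructure
open Literature.AlgebraicGeometry.HodgeTheory
open Literature.AlgebraicGeometry.Milne1999 (IsOfCMType)

variable [HodgeTensorFacts.{0, 0}] {X : AbelianVariety ℂ} {n : ℕ}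

/-! ## §0 Poincaré: a non-simple fourfold is `E × T` or `S × S'`; four curves as a biproduct -/

omit [HodgeTensorFacts.{0, 0}] in
/-- **A non-simple abelian fourfold is isogenous to `A × B` with `(dim A, dim B) = (1, 3)` or `(2, 2)`** (an abelian subvariety `B ↪ X` with
`0 < dim B < 4` and its Poincaré complement). [cite: MumfordAV1970, §19 Thm. 1] -/
theorem exists_prod_isIsogenous_of_not_isSimple_fourfold (hX4 : X.dim = 4) (hns : ¬ X.IsSimple) :
    ∃ A B : AbelianVariety ℂ, (A.dim = 1 ∧ B.dim = 3 ∨ A.dim = 2 ∧ B.dim = 2) ∧ IsIsogenous X (A.prod B) := by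
  obtain ⟨B, f, hf, hB0, hBX⟩ := exists_abelianSubvariety_of_not_isSimple hns
  haveI := hf
  obtain ⟨Z, j, _, hσ⟩ := poincare_complete_reducibility f
  have hdim : B.dim + Z.dim = X.dim := by
    rw [← dim_prod, ← dim_eq_of_isIsogeny (isIsogeny_hom_of_iso (biprodIsoProd B Z)), dim_eq_of_isIsogeny hσ]
  have hiso : IsIsogenous X (B.prod Z) :=
    IsIsogenous.symm' ⟨(biprodIsoProd B Z).inv ≫ biprod.desc f j, isIsogeny_comp (isIsogeny_hom_of_iso (biprodIsoProd B Z).symm) hσ⟩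
  rcases (by omega : B.dim = 1 ∨ B.dim = 2 ∨ B.dim = 3) with h1 | h2 | h3
  · exact ⟨B, Z, Or.inl ⟨h1, by omega⟩, hiso⟩
  · exact ⟨B, Z, Or.inr ⟨h2, by omega⟩, hiso⟩
  · exact ⟨Z, B, Or.inl ⟨by omega, h3⟩, hiso.trans (Literature.AlgebraicGeometry.HodgeTheory.isIsogenous_prod_comm B Z)⟩

omit [HodgeTensorFacts.{0, 0}] in
/-- `E₀ × (E₁ × (E₂ × E₃)) ∼ ⨁_{Fin 4} ![E₀, E₁, E₂, E₃]`. [cite: MumfordAV1970, §19 Thm. 1] -/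
theorem isIsogenous_prod_prod_prod_biproduct_four (E₀ E₁ E₂ E₃ : AbelianVariety ℂ) :
    IsIsogenous (E₀.prod (E₁.prod (E₂.prod E₃))) (⨁ (![E₀, E₁, E₂, E₃] : Fin 4 → AbelianVariety ℂ)) := by
  obtain ⟨h, g, hhg, hgh⟩ := AndreRiemann.biproduct_succ_split (![E₀, E₁, E₂, E₃] : Fin 4 → AbelianVariety ℂ)
  have hh : IsIsogeny h := isIsogeny_of_comp_eq_of_comp_eq (isIsogeny_id _) (isIsogeny_id _) hgh hhg
  have htail : (![E₀, E₁, E₂, E₃] : Fin 4 → AbelianVariety ℂ) ∘ Fin.succ = ![E₁, E₂, E₃] := funext fun i => by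
    fin_cases i <;> rfl
  have h1 : IsIsogenous (⨁ (![E₀, E₁, E₂, E₃] : Fin 4 → AbelianVariety ℂ)) (E₀.prod (⨁ ((![E₀, E₁, E₂, E₃] : Fin 4 → AbelianVariety ℂ) ∘ Fin.succ))) :=
    ⟨h, hh⟩
  rw [htail] at h1
  exact (h1.trans ((IsIsogenous.refl E₀).prod (biproduct_three_isIsogenous_prod_prod ![E₁, E₂, E₃]))).symm'

/-! ## §1 The membership theorem -/

/-- **The Mumford–Tate rank of a NON-SIMPLE complex abelian fourfold lies in `{2, 3, 4, 5, 6, 7, 8, 9, 10, 11, 12, 13, 14, 15, 17, 21, 23, 25}`.**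
Cases `E × T` (`T` simple: partition `{1,3}`; `T ∼ E' × S'`: `{2,1,1}` or `{1,1,1,1}`) and `S × S'` (`{2,2}`, `{2,1,1}`, `{1,1,1,1}`).
[cite: MoonenZarhin1999LowDim, §3 and §5 (5.4)] [cite: MumfordAV1970, §19 Thm. 1] -/
theorem mtRank_hodge_one_mem_of_not_isSimple_fourfold (hX : IsSmoothProjective n X.X) (hX4 : X.dim = 4) (hns : ¬ X.IsSimple) :
    haveI := BettiUniverse.finite hX 1
    (BettiUniverse.hodge exists_isReal_hodgeModel_holds hX 1).mtRank ∈
      ({2, 3, 4, 5, 6, 7, 8, 9, 10, 11, 12, 13, 14, 15, 17, 21, 23, 25} : Finset ℕ) := by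
  classical
  haveI := BettiUniverse.finite hX 1
  simp only [Finset.mem_insert, Finset.mem_singleton]
  obtain ⟨A, B, hdims, hXP⟩ := exists_prod_isIsogenous_of_not_isSimple_fourfold hX4 hns
  rcases hdims with ⟨hA1, hB3⟩ | ⟨hA2, hB2⟩
  · -- curve × threefold
    by_cases hBs : B.IsSimple
    · have h := mtRank_hodge_one_mem_of_isIsogenous_curve_prod_isSimple_threefold hX hA1 hBs hB3 hXP
      simp only [Set.mem_insert_iff, Set.mem_singleton_iff] at h
      omega
    · obtain ⟨E', S', hE'1, hS'2, hB⟩ := exists_curve_prod_surface_isIsogenous_of_not_isSimple_threefold hB3 hBs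
      have hXP' : IsIsogenous X (A.prod (E'.prod S')) := hXP.trans ((IsIsogenous.refl A).prod hB.symm')
      by_cases hS's : S'.IsSimple
      · have hXQ : IsIsogenous X (S'.prod (A.prod E')) :=
          (hXP'.trans (Summit.HodgeConjecture.CorCM.isIsogenous_prod_assoc A E' S')).trans
            (Literature.AlgebraicGeometry.HodgeTheory.isIsogenous_prod_comm (A.prod E') S')
        have h := mtRank_hodge_one_mem_of_isIsogenous_simpleSurface_prod_curves hX hS's hS'2 hA1 hE'1 hXQ
        simp only [Finset.mem_insert, Finset.mem_singleton] at h
        omega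
      · obtain ⟨E'', E''', hE''1, hE'''1, hS'⟩ := exists_isIsogenous_prod_of_not_isSimple_surface hS'2 hS's
        have hX4c : IsIsogenous X (⨁ (![A, E', E'', E'''] : Fin 4 → AbelianVariety ℂ)) :=
          (hXP'.trans ((IsIsogenous.refl A).prod ((IsIsogenous.refl E').prod hS'))).trans
            (isIsogenous_prod_prod_prod_biproduct_four A E' E'' E''')
        have h := mtRank_hodge_one_mem_of_biproduct_four_curves hX (E := ![A, E', E'', E'''])
          (fun j => by fin_cases j <;> assumption) hX4c
        simp only [Finset.mem_insert, Finset.mem_singleton] at h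
        omega
  · -- surface × surface
    by_cases hAs : A.IsSimple <;> by_cases hBs : B.IsSimple
    · have h := mtRank_hodge_one_mem_of_isIsogenous_prod_simpleSurfaces hX hAs hA2 hBs hB2 hXP
      simp only [Set.mem_insert_iff, Set.mem_singleton_iff] at h
      omega
    · obtain ⟨E, E', hE1, hE'1, hB⟩ := exists_isIsogenous_prod_of_not_isSimple_surface hB2 hBs
      have hXQ : IsIsogenous X (A.prod (E.prod E')) := hXP.trans ((IsIsogenous.refl A).prod hB)
      have h := mtRank_hodge_one_mem_of_isIsogenous_simpleSurface_prod_curves hX hAs hA2 hE1 hE'1 hXQ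
      simp only [Finset.mem_insert, Finset.mem_singleton] at h
      omega
    · obtain ⟨E, E', hE1, hE'1, hA⟩ := exists_isIsogenous_prod_of_not_isSimple_surface hA2 hAs
      have hXQ : IsIsogenous X (B.prod (E.prod E')) :=
        (hXP.trans (Literature.AlgebraicGeometry.HodgeTheory.isIsogenous_prod_comm A B)).trans ((IsIsogenous.refl B).prod hA)
      have h := mtRank_hodge_one_mem_of_isIsogenous_simpleSurface_prod_curves hX hBs hB2 hE1 hE'1 hXQ
      simp only [Finset.mem_insert, Finset.mem_singleton] at h
      omega
    · obtain ⟨E, E', hE1, hE'1, hA⟩ := exists_isIsogenous_prod_of_not_isSimple_surface hA2 hAs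
      obtain ⟨E'', E''', hE''1, hE'''1, hB⟩ := exists_isIsogenous_prod_of_not_isSimple_surface hB2 hBs
      have hX4c : IsIsogenous X (⨁ (![E, E', E'', E'''] : Fin 4 → AbelianVariety ℂ)) :=
        ((hXP.trans (hA.prod hB)).trans (Literature.AlgebraicGeometry.HodgeTheory.isIsogenous_prod_assoc E E' (E''.prod E'''))).trans
          (isIsogenous_prod_prod_prod_biproduct_four E E' E'' E''')
      have h := mtRank_hodge_one_mem_of_biproduct_four_curves hX (E := ![E, E', E'', E'''])
        (fun j => by fin_cases j <;> assumption) hX4c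
      simp only [Finset.mem_insert, Finset.mem_singleton] at h
      omega

/-- **A non-simple complex abelian fourfold never has Mumford–Tate rank `16, 18, 19, 20, 22, 24` or `≥ 26`** (and never `0, 1`).
[cite: MoonenZarhin1999LowDim, §3 and §5 (5.4)] -/
theorem mtRank_hodge_one_not_mem_of_not_isSimple_fourfold (hX : IsSmoothProjective n X.X) (hX4 : X.dim = 4) (hns : ¬ X.IsSimple) :
    haveI := BettiUniverse.finite hX 1
    (BettiUniverse.hodge exists_isReal_hodgeModel_holds hX 1).mtRank ∉ ({16, 18, 19, 20, 22, 24} : Finset ℕ) ∧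
      2 ≤ (BettiUniverse.hodge exists_isReal_hodgeModel_holds hX 1).mtRank ∧ (BettiUniverse.hodge exists_isReal_hodgeModel_holds hX 1).mtRank ≤ 25 := by
  have h := mtRank_hodge_one_mem_of_not_isSimple_fourfold hX hX4 hns
  simp only [Finset.mem_insert, Finset.mem_singleton] at h ⊢
  omega

end Summit.HodgeConjecture.CorCM

end
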